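import Literature.Computability.Cryptography.WordRAMWidth
import HarnessLib

/-!
# The word RAM — inline simulation of oracle calls, I: layout, copy loops, prologue, epilogue

The concrete machine behind the transfer property of fine-grained reductions
(V. Vassilevska Williams, ICM 2018, §2, the remark after Def. 2.1): an oracle word RAM `M`
(word size `ws = k · w`, `w = inputWidth x`) is run inside an oracle-free word RAM `M'` at word
size `W = k' · w`, each oracle query being answered by an inline run of the oracle problem's own
algorithm `M_B`. This file fixes the **memory layout** of `M'` and provides its
oracle-independent parts:

* registers `0 … 39` (literal addresses); with `Q = 2 ^ (W - 2)`: `M`-cell `a` at `40 + a`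
  (`a < Q - 40`), `M`-stamps at `Q + a` (all `0` forever), `B`-cell `j` at `2Q + j`, `B`-stamp at
  `3Q + j` (`Inline.LM`, `Inline.LB`, `Inline.EM`, `Inline.EB`, `envOK_M`, `envOK_B`);
* the ascending copy loop `cuBody` (`iterate_cuBody`), the descending relocation loop `rdBody`
  (`iterate_rdBody`) and the reduction loop `modBody` (`iterate_modBody`);
* the **prologue** `PRO k` (88 instructions at position `0`): relocates the input `x` from cells
  `0 … |x|` to the `M`-region using cell `0` as the only initially free pointer, reduces it modulo
  `2 ^ ws` (computed by the width routine of `…WordRAMWidth`), and sets up the environment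
  registers; `run_PRO`: from `init W x` it reaches position `88` within `proCost |x| W` steps in a
  configuration whose `M`-region holds `init ws x` and whose registers hold the two environments;
* the **epilogue** `EPI pos` (100 instructions): copies the output of the emulated `M` back to
  cells `0 … ℓ` and halts; `run_EPI`.

## References

* V. Vassilevska Williams, *On some fine-grained questions in algorithms and complexity*,
  Proc. ICM 2018, §2 (Def. 2.1 and the remark following it).
* T. Hagerup, *Sorting and searching on the word RAM*, STACS 1998, §2.
-/

namespace Literature.Computability.Cryptography.WordRAM

open StateTransition

namespace Inline

/-! ## Layout and environments -/

/-- The layout of the emulated reduction `M`: base register `4` (holds `40`), stamp-base register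
`5` (holds `Q`), generation register `6` (holds `0`), modulus register `7`, temporaries
`12, 13, 14`. [folklore] -/
def LM : Layout := ⟨4, 5, 6, 7, 12, 13, 14⟩

/-- The layout of the emulated oracle algorithm `M_B`: registers `8` (`2Q`), `9` (`3Q`), `10`
(generation = number of queries so far), `11` (modulus), temporaries `12, 13, 14`. [folklore] -/
def LB : Layout := ⟨8, 9, 10, 11, 12, 13, 14⟩

/-- A quarter of the address space. [folklore] -/
def Qv (W : ℕ) : ℕ := 2 ^ (W - 2)

/-- The environment of `M` at target word size `W` and emulated word size `ws`. [folklore] -/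
def EM (W ws : ℕ) : Env := ⟨40, Qv W, 0, ws, Qv W - 40⟩

/-- The environment of `M_B`: generation `g`, emulated word size `wsB`. [folklore] -/
def EB (W g wsB : ℕ) : Env := ⟨2 * Qv W, 3 * Qv W, g, wsB, Qv W⟩

/-- Four quarters make the address space. [folklore] -/
theorem four_mul_Qv {W : ℕ} (hW : 2 ≤ W) : 4 * Qv W = 2 ^ W := by
  obtain ⟨k, rfl⟩ := Nat.exists_eq_add_of_le hW
  simp [Qv, Nat.pow_add, Nat.mul_comm]

/-- The quarter is at least `64` for `W ≥ 8`. [folklore] -/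
theorem Qv_ge {W : ℕ} (hW : 8 ≤ W) : 64 ≤ Qv W := by
  have : 2 ^ 6 ≤ 2 ^ (W - 2) := Nat.pow_le_pow_right (by norm_num) (by omega)
  simpa [Qv] using this

/-- Conversely, a quarter larger than `32` forces `8 ≤ W`. [folklore] -/
theorem eight_le_of_Qv {W : ℕ} (h : 32 < Qv W) : 8 ≤ W := by
  by_contra hW
  have : 2 ^ (W - 2) ≤ 2 ^ 5 := Nat.pow_le_pow_right (by norm_num) (by omega)
  simp [Qv] at h this
  omega

/-- Register `rB` of the `M`-layout. [folklore] -/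
@[simp] theorem LM_rB : LM.rB = 4 := rfl
/-- Register `rS` of the `M`-layout. [folklore] -/
@[simp] theorem LM_rS : LM.rS = 5 := rfl
/-- Register `rGen` of the `M`-layout. [folklore] -/
@[simp] theorem LM_rGen : LM.rGen = 6 := rfl
/-- Register `rP` of the `M`-layout. [folklore] -/
@[simp] theorem LM_rP : LM.rP = 7 := rfl
/-- Scratch register `t1` of the `M`-layout. [folklore] -/
@[simp] theorem LM_t1 : LM.t1 = 12 := rfl
/-- Scratch register `t2` of the `M`-layout. [folklore] -/
@[simp] theorem LM_t2 : LM.t2 = 13 := rfl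
/-- Scratch register `ta` of the `M`-layout. [folklore] -/
@[simp] theorem LM_ta : LM.ta = 14 := rfl
/-- Register `rB` of the `B`-layout. [folklore] -/
@[simp] theorem LB_rB : LB.rB = 8 := rfl
/-- Register `rS` of the `B`-layout. [folklore] -/
@[simp] theorem LB_rS : LB.rS = 9 := rfl
/-- Register `rGen` of the `B`-layout. [folklore] -/
@[simp] theorem LB_rGen : LB.rGen = 10 := rfl
/-- Register `rP` of the `B`-layout. [folklore] -/
@[simp] theorem LB_rP : LB.rP = 11 := rfl
/-- Scratch register `t1` of the `B`-layout. [folklore] -/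
@[simp] theorem LB_t1 : LB.t1 = 12 := rfl
/-- Scratch register `t2` of the `B`-layout. [folklore] -/
@[simp] theorem LB_t2 : LB.t2 = 13 := rfl
/-- Scratch register `ta` of the `B`-layout. [folklore] -/
@[simp] theorem LB_ta : LB.ta = 14 := rfl
/-- Cell base of the `M`-environment. [folklore] -/
@[simp] theorem EM_Bv (W ws : ℕ) : (EM W ws).Bv = 40 := rfl
/-- Stamp base of the `M`-environment. [folklore] -/
@[simp] theorem EM_Sv (W ws : ℕ) : (EM W ws).Sv = Qv W := rfl
/-- Generation of the `M`-environment (always `0`). [folklore] -/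
@[simp] theorem EM_Gv (W ws : ℕ) : (EM W ws).Gv = 0 := rfl
/-- Emulated word size of the `M`-environment. [folklore] -/
@[simp] theorem EM_ws (W ws : ℕ) : (EM W ws).ws = ws := rfl
/-- Region size of the `M`-environment. [folklore] -/
@[simp] theorem EM_Q (W ws : ℕ) : (EM W ws).Q = Qv W - 40 := rfl
/-- Cell base of the `B`-environment. [folklore] -/
@[simp] theorem EB_Bv (W g wsB : ℕ) : (EB W g wsB).Bv = 2 * Qv W := rfl
/-- Stamp base of the `B`-environment. [folklore] -/
@[simp] theorem EB_Sv (W g wsB : ℕ) : (EB W g wsB).Sv = 3 * Qv W := rfl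
/-- Generation of the `B`-environment. [folklore] -/
@[simp] theorem EB_Gv (W g wsB : ℕ) : (EB W g wsB).Gv = g := rfl
/-- Emulated word size of the `B`-environment. [folklore] -/
@[simp] theorem EB_ws (W g wsB : ℕ) : (EB W g wsB).ws = wsB := rfl
/-- Region size of the `B`-environment. [folklore] -/
@[simp] theorem EB_Q (W g wsB : ℕ) : (EB W g wsB).Q = Qv W := rfl

/-- The registers of the `M`-layout. [folklore] -/
theorem LM_regs : LM.regs = [4, 5, 6, 7, 12, 13, 14] := rfl
/-- The registers of the `B`-layout. [folklore] -/
theorem LB_regs : LB.regs = [8, 9, 10, 11, 12, 13, 14] := rfl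

/-- The static side conditions of the `M`-emulation. [folklore] -/
theorem envOK_M {W ws : ℕ} (hW : 8 ≤ W) (hws : ws ≤ W) : EnvOK LM (EM W ws) W := by
  have hQ := Qv_ge hW
  have h4 := four_mul_Qv (show 2 ≤ W by omega)
  refine ⟨by decide, by decide, by decide, by decide, by decide, by decide, by decide, ?_, ?_, ?_, ?_, ?_⟩
  · intro r hr
    simp only [LM_regs, List.mem_cons, List.mem_nil_iff, or_false] at hr
    simp only [EM_Bv, EM_Sv]
    rcases hr with rfl | rfl | rfl | rfl | rfl | rfl | rfl <;> omega
  · left; simp only [EM_Bv, EM_Q, EM_Sv]; omega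
  · simp only [EM_Bv, EM_Q]; omega
  · simp only [EM_Sv, EM_Q]; omega
  · simpa using hws

/-- The static side conditions of the `M_B`-emulation. [folklore] -/
theorem envOK_B {W g wsB : ℕ} (hW : 8 ≤ W) (hws : wsB ≤ W) : EnvOK LB (EB W g wsB) W := by
  have hQ := Qv_ge hW
  have h4 := four_mul_Qv (show 2 ≤ W by omega)
  refine ⟨by decide, by decide, by decide, by decide, by decide, by decide, by decide, ?_, ?_, ?_, ?_, ?_⟩
  · intro r hr
    simp only [LB_regs, List.mem_cons, List.mem_nil_iff, or_false] at hr
    simp only [EB_Bv, EB_Sv]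
    rcases hr with rfl | rfl | rfl | rfl | rfl | rfl | rfl <;> omega
  · left; simp only [EB_Bv, EB_Q, EB_Sv]; omega
  · simp only [EB_Bv, EB_Q]; omega
  · simp only [EB_Sv, EB_Q]; omega
  · simpa using hws

/-- The `M`-layout registers are small. [folklore] -/
theorem LM_regs_le {V : ℕ} (hV : 14 ≤ V) : ∀ r ∈ LM.regs, r ≤ V := by
  intro r hr
  simp only [LM_regs, List.mem_cons, List.mem_nil_iff, or_false] at hr
  rcases hr with rfl | rfl | rfl | rfl | rfl | rfl | rfl <;> omega

/-- The `B`-layout registers are small. [folklore] -/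
theorem LB_regs_le {V : ℕ} (hV : 14 ≤ V) : ∀ r ∈ LB.regs, r ≤ V := by
  intro r hr
  simp only [LB_regs, List.mem_cons, List.mem_nil_iff, or_false] at hr
  rcases hr with rfl | rfl | rfl | rfl | rfl | rfl | rfl <;> omega

/-- The footprint of the `M`-emulation lies in `{12, 13, 14} ∪ [40, 2Q)`. [folklore] -/
theorem foot_M {W ws c : ℕ} (hW : 8 ≤ W) (h : Foot LM (EM W ws) c) :
    c = 12 ∨ c = 13 ∨ c = 14 ∨ (40 ≤ c ∧ c < 2 * Qv W) := by
  have hQ := Qv_ge hW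
  simp only [Foot, LM_t1, LM_t2, LM_ta, EM_Bv, EM_Q, EM_Sv] at h
  omega

/-- The footprint of the `M_B`-emulation lies in `{12, 13, 14} ∪ [2Q, 4Q)`. [folklore] -/
theorem foot_B {W g wsB c : ℕ} (h : Foot LB (EB W g wsB) c) :
    c = 12 ∨ c = 13 ∨ c = 14 ∨ (2 * Qv W ≤ c ∧ c < 4 * Qv W) := by
  simp only [Foot, LB_t1, LB_t2, LB_ta, EB_Bv, EB_Q, EB_Sv] at h
  omega

/-- With all `M`-stamps zero (generation `0`), the emulated `M`-memory is the raw region. [folklore] -/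
theorem edec_M_eq {W ws : ℕ} {mem : ℕ → ℕ} (hst : StampLE (EM W ws) mem) {a : ℕ}
    (ha : a < Qv W - 40) : edec (EM W ws) mem a = mem (40 + a) := by
  have := hst a (by simpa using ha)
  simp only [EM_Sv, EM_Gv, Nat.le_zero] at this
  simp [edec, this]

/-! ## Copy loops -/

/-- Ascending copy: `mem[R33] := mem[R19]; R19 += 1; R33 += 1; R20 -= 1`. [folklore] -/
def cuBody : List OpSpec :=
  [(.div, .ind 33, .ind 19, .imm 1), (.add, .dir 19, .dir 19, .imm 1), (.add, .dir 33, .dir 33, .imm 1),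
   (.sub, .dir 20, .dir 20, .imm 1)]

/-- Length of `cuBody`. [folklore] -/
@[simp] theorem cuBody_length : cuBody.length = 4 := rfl

/-- The memory after `j` rounds of the ascending copy from source `s₀`, destination `d₀`,
count `n`. [folklore] -/
def cuMem (mem : ℕ → ℕ) (s₀ d₀ n j : ℕ) : ℕ → ℕ := fun a =>
  if a = 19 then s₀ + j else if a = 33 then d₀ + j else if a = 20 then n - j
  else if d₀ ≤ a ∧ a < d₀ + j then mem (s₀ + (a - d₀)) else mem a

/-- Semantics of one round of the upward copy loop. [folklore] -/
theorem execOps_cuBody {W : ℕ} (mem : ℕ → ℕ) (h33 : 40 ≤ mem 33)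
    (hs : mem 19 + 1 < 2 ^ W) (hd : mem 33 + 1 < 2 ^ W) (hc : 1 ≤ mem 20) (hc' : mem 20 < 2 ^ W) :
    execOps W mem cuBody =
      Function.update (Function.update (Function.update
        (Function.update mem (mem 33) (mem (mem 19))) 19 (mem 19 + 1)) 33 (mem 33 + 1)) 20 (mem 20 - 1) := by
  have hne19 : mem 33 ≠ 19 := by omega
  have hne33 : mem 33 ≠ 33 := by omega
  have hne20 : mem 33 ≠ 20 := by omega
  simp only [cuBody, execOps_cons, execOps_nil, execOp_dir, execOp_ind, Operand.read_dir,
    Operand.read_ind, Operand.read_imm, BinOp.eval, Nat.div_one]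
  simp (config := { decide := true }) only [Function.update_of_ne, ne_eq,
    Ne.symm hne19, Ne.symm hne33, Ne.symm hne20, not_false_eq_true,
    Nat.mod_eq_of_lt hs, Nat.mod_eq_of_lt hd, sub_eval_of_le hc hc']

/-- **The ascending copy loop.** From `R19 = s₀`, `R33 = d₀`, `R20 = n` (`s₀, d₀ ≥ 40`, and either
the source segment ends below the destination or the destination starts below the source), after
`j ≤ n` rounds the memory is `cuMem mem s₀ d₀ n j`. [folklore] -/
theorem iterate_cuBody {W : ℕ} {mem : ℕ → ℕ} {s₀ d₀ n : ℕ} (hs : 40 ≤ s₀) (hd : 40 ≤ d₀)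
    (hsW : s₀ + n < 2 ^ W) (hdW : d₀ + n < 2 ^ W) (hdisj : s₀ + n ≤ d₀ ∨ d₀ ≤ s₀)
    (h19 : mem 19 = s₀) (h33 : mem 33 = d₀) (h20 : mem 20 = n) :
    ∀ j, j ≤ n → (fun m => execOps W m cuBody)^[j] mem = cuMem mem s₀ d₀ n j
  | 0, _ => by
      funext a
      simp only [Function.iterate_zero, id_eq, cuMem, Nat.add_zero, Nat.sub_zero]
      split_ifs with h1 h2 h3 h4
      · rw [h1, h19]
      · rw [h2, h33]
      · rw [h3, h20]
      · omega
      · rfl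
  | j + 1, hj => by
      rw [Function.iterate_succ_apply', iterate_cuBody hs hd hsW hdW hdisj h19 h33 h20 j (by omega)]
      have e19 : cuMem mem s₀ d₀ n j 19 = s₀ + j := by simp [cuMem]
      have e33 : cuMem mem s₀ d₀ n j 33 = d₀ + j := by simp [cuMem]
      have e20 : cuMem mem s₀ d₀ n j 20 = n - j := by simp [cuMem]
      have esrc : cuMem mem s₀ d₀ n j (s₀ + j) = mem (s₀ + j) := by
        simp only [cuMem]
        rw [if_neg (by omega), if_neg (by omega), if_neg (by omega), if_neg (by omega)]
      rw [execOps_cuBody (W := W) _ (by rw [e33]; omega) (by rw [e19]; omega)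
        (by rw [e33]; omega) (by rw [e20]; omega) (by rw [e20]; omega), e19, e33, e20, esrc]
      funext a
      simp only [cuMem, Function.update_apply]
      by_cases a20 : a = 20
      · simp [a20]; omega
      simp only [a20, if_false]
      by_cases a33 : a = 33
      · simp [a33]; omega
      simp only [a33, if_false]
      by_cases a19 : a = 19
      · simp [a19]; omega
      simp only [a19, if_false]
      by_cases ha : a = d₀ + j
      · subst ha
        have hc : d₀ ≤ d₀ + j ∧ d₀ + j < d₀ + (j + 1) := ⟨by omega, by omega⟩
        simp only [hc, and_self, if_true, Nat.add_sub_cancel_left]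
      · rw [if_neg ha]
        by_cases hr : d₀ ≤ a ∧ a < d₀ + (j + 1)
        · rw [if_pos hr, if_pos ⟨hr.1, by omega⟩]
        · rw [if_neg hr, if_neg (fun h => hr ⟨h.1, by omega⟩)]

/-- Descending relocation by `40`: `mem[R0] := mem[R2]; R2 -= 1; R0 -= 1; R1 -= 1`
(the destination pointer `R0` is always the source pointer plus `40`). [folklore] -/
def rdBody : List OpSpec :=
  [(.div, .ind 0, .ind 2, .imm 1), (.sub, .dir 2, .dir 2, .imm 1), (.sub, .dir 0, .dir 0, .imm 1),
   (.sub, .dir 1, .dir 1, .imm 1)]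

/-- Length of `rdBody`. [folklore] -/
@[simp] theorem rdBody_length : rdBody.length = 4 := rfl
/-- Largest constant of `rdBody`. [folklore] -/
theorem opsMaxConst_rdBody : opsMaxConst rdBody = 2 := by decide

/-- The memory after `j` rounds of the descending relocation from source `s₀` (destination
`s₀ + 40`), count `n`. [folklore] -/
def rdMem (mem : ℕ → ℕ) (s₀ n j : ℕ) : ℕ → ℕ := fun a =>
  if a = 0 then s₀ + 40 - j else if a = 2 then s₀ - j else if a = 1 then n - j
  else if s₀ + 40 < a + j ∧ a ≤ s₀ + 40 then mem (a - 40) else mem a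

/-- Semantics of one round of the downward relocation loop. [folklore] -/
theorem execOps_rdBody {W : ℕ} (mem : ℕ → ℕ) (h0 : 41 ≤ mem 0) (h2 : 1 ≤ mem 2)
    (h0W : mem 0 < 2 ^ W) (h2W : mem 2 < 2 ^ W) (hc : 1 ≤ mem 1) (hc' : mem 1 < 2 ^ W) :
    execOps W mem rdBody =
      Function.update (Function.update (Function.update
        (Function.update mem (mem 0) (mem (mem 2))) 2 (mem 2 - 1)) 0 (mem 0 - 1)) 1 (mem 1 - 1) := by
  have hne0 : mem 0 ≠ 0 := by omega
  have hne1 : mem 0 ≠ 1 := by omega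
  have hne2 : mem 0 ≠ 2 := by omega
  simp only [rdBody, execOps_cons, execOps_nil, execOp_dir, execOp_ind, Operand.read_dir,
    Operand.read_ind, Operand.read_imm, BinOp.eval, Nat.div_one]
  simp (config := { decide := true }) only [Function.update_of_ne, ne_eq,
    Ne.symm hne0, Ne.symm hne1, Ne.symm hne2, not_false_eq_true,
    sub_eval_of_le h2 h2W, sub_eval_of_le (show 1 ≤ mem 0 by omega) h0W, sub_eval_of_le hc hc']

/-- **The descending relocation loop.** From `R2 = s₀`, `R0 = s₀ + 40`, `R1 = n` with
`n + 3 ≤ s₀` (so sources stay `≥ 4` and never meet the registers) and `s₀ + 40 < 2 ^ W`, after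
`j ≤ n` rounds the memory is `rdMem mem s₀ n j`. [folklore] -/
theorem iterate_rdBody {W : ℕ} {mem : ℕ → ℕ} {s₀ n : ℕ} (hn : n + 3 ≤ s₀) (hsW : s₀ + 40 < 2 ^ W)
    (h2 : mem 2 = s₀) (h0 : mem 0 = s₀ + 40) (h1 : mem 1 = n) :
    ∀ j, j ≤ n → (fun m => execOps W m rdBody)^[j] mem = rdMem mem s₀ n j
  | 0, _ => by
      funext a
      simp only [Function.iterate_zero, id_eq, rdMem, Nat.sub_zero, Nat.add_zero]
      split_ifs with ha0 ha2 ha1 h4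
      · rw [ha0, h0]
      · rw [ha2, h2]
      · rw [ha1, h1]
      · omega
      · rfl
  | j + 1, hj => by
      rw [Function.iterate_succ_apply', iterate_rdBody hn hsW h2 h0 h1 j (by omega)]
      have e0 : rdMem mem s₀ n j 0 = s₀ + 40 - j := by simp [rdMem]
      have e2 : rdMem mem s₀ n j 2 = s₀ - j := by simp [rdMem]
      have e1 : rdMem mem s₀ n j 1 = n - j := by simp [rdMem]
      have esrc : rdMem mem s₀ n j (s₀ - j) = mem (s₀ - j) := by
        simp only [rdMem]
        rw [if_neg (by omega), if_neg (by omega), if_neg (by omega), if_neg (by omega)]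
      rw [execOps_rdBody (W := W) _ (by rw [e0]; omega) (by rw [e2]; omega) (by rw [e0]; omega)
        (by rw [e2]; omega) (by rw [e1]; omega) (by rw [e1]; omega), e0, e2, e1, esrc]
      funext a
      simp only [rdMem, Function.update_apply]
      by_cases a1 : a = 1
      · simp [a1]; omega
      simp only [a1, if_false]
      by_cases a0 : a = 0
      · simp [a0]; omega
      simp only [a0, if_false]
      by_cases a2 : a = 2
      · simp [a2]; omega
      simp only [a2, if_false]
      by_cases ha : a = s₀ + 40 - j
      · subst ha
        have hc : s₀ + 40 < s₀ + 40 - j + (j + 1) ∧ s₀ + 40 - j ≤ s₀ + 40 := ⟨by omega, by omega⟩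
        simp only [hc, and_self, if_true]
        congr 1; omega
      · rw [if_neg ha]
        by_cases hr : s₀ + 40 < a + (j + 1) ∧ a ≤ s₀ + 40
        · rw [if_pos hr, if_pos ⟨by omega, hr.2⟩]
        · rw [if_neg hr, if_neg (fun h => hr ⟨by omega, h.2⟩)]

/-- Reduction modulo the word: `mem[R19] := mem[R19] % R7; R19 += 1; R20 -= 1`. [folklore] -/
def modBody : List OpSpec :=
  [(.mod, .ind 19, .ind 19, .dir 7), (.add, .dir 19, .dir 19, .imm 1), (.sub, .dir 20, .dir 20, .imm 1)]

/-- Length of `modBody`. [folklore] -/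
@[simp] theorem modBody_length : modBody.length = 3 := rfl
/-- Largest constant of `modBody`. [folklore] -/
theorem opsMaxConst_modBody : opsMaxConst modBody = 20 := by decide

/-- The memory after `j` rounds of the reduction loop from pointer `p₀`, count `n`, modulus `P`. [folklore] -/
def modMem (mem : ℕ → ℕ) (P p₀ n j : ℕ) : ℕ → ℕ := fun a =>
  if a = 19 then p₀ + j else if a = 20 then n - j
  else if p₀ ≤ a ∧ a < p₀ + j then mem a % P else mem a

/-- Semantics of one round of the reduction loop. [folklore] -/
theorem execOps_modBody {W : ℕ} (mem : ℕ → ℕ) (h19 : 40 ≤ mem 19) (hs : mem 19 + 1 < 2 ^ W)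
    (hc : 1 ≤ mem 20) (hc' : mem 20 < 2 ^ W) :
    execOps W mem modBody =
      Function.update (Function.update
        (Function.update mem (mem 19) (mem (mem 19) % mem 7)) 19 (mem 19 + 1)) 20 (mem 20 - 1) := by
  have hne19 : mem 19 ≠ 19 := by omega
  have hne20 : mem 19 ≠ 20 := by omega
  have hne7 : mem 19 ≠ 7 := by omega
  simp only [modBody, execOps_cons, execOps_nil, execOp_dir, execOp_ind, Operand.read_dir,
    Operand.read_ind, Operand.read_imm, BinOp.eval]
  simp (config := { decide := true }) only [Function.update_of_ne, ne_eq,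
    Ne.symm hne19, Ne.symm hne20, not_false_eq_true,
    Nat.mod_eq_of_lt hs, sub_eval_of_le hc hc']

/-- **The reduction loop.** From `R19 = p₀ ≥ 40`, `R20 = n`, modulus `P` in register `7`, after
`j ≤ n` rounds the memory is `modMem mem P p₀ n j`. [folklore] -/
theorem iterate_modBody {W : ℕ} {mem : ℕ → ℕ} {P p₀ n : ℕ} (hp : 40 ≤ p₀) (hpW : p₀ + n < 2 ^ W)
    (h7 : mem 7 = P) (h19 : mem 19 = p₀) (h20 : mem 20 = n) :
    ∀ j, j ≤ n → (fun m => execOps W m modBody)^[j] mem = modMem mem P p₀ n j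
  | 0, _ => by
      funext a
      simp only [Function.iterate_zero, id_eq, modMem, Nat.add_zero, Nat.sub_zero]
      split_ifs with h1 h2 h3
      · rw [h1, h19]
      · rw [h2, h20]
      · omega
      · rfl
  | j + 1, hj => by
      rw [Function.iterate_succ_apply', iterate_modBody hp hpW h7 h19 h20 j (by omega)]
      have e19 : modMem mem P p₀ n j 19 = p₀ + j := by simp [modMem]
      have e20 : modMem mem P p₀ n j 20 = n - j := by simp [modMem]
      have e7 : modMem mem P p₀ n j 7 = P := by
        simp only [modMem]; rw [if_neg (by omega), if_neg (by omega), if_neg (by omega), h7]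
      have esrc : modMem mem P p₀ n j (p₀ + j) = mem (p₀ + j) := by
        simp only [modMem]; rw [if_neg (by omega), if_neg (by omega), if_neg (by omega)]
      rw [execOps_modBody (W := W) _ (by rw [e19]; omega) (by rw [e19]; omega) (by rw [e20]; omega)
        (by rw [e20]; omega), e19, e20, e7, esrc]
      funext a
      simp only [modMem, Function.update_apply]
      by_cases a20 : a = 20
      · simp [a20]; omega
      simp only [a20, if_false]
      by_cases a19 : a = 19
      · simp [a19]; omega
      simp only [a19, if_false]
      by_cases ha : a = p₀ + j
      · subst ha
        have hc : p₀ ≤ p₀ + j ∧ p₀ + j < p₀ + (j + 1) := ⟨by omega, by omega⟩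
        simp only [hc, and_self, if_true]
      · rw [if_neg ha]
        by_cases hr : p₀ ≤ a ∧ a < p₀ + (j + 1)
        · rw [if_pos hr, if_pos ⟨hr.1, by omega⟩]
        · rw [if_neg hr, if_neg (fun h => hr ⟨h.1, by omega⟩)]

/-! ## The prologue -/

/-- Phase 0: save cells `1, 2, 3` above the input, using cell `0` (which holds `L = |x|`) as the
only pointer: `R0 += 80; mem[R0] := R1; R0 += 1; mem[R0] := R2; R0 += 1; mem[R0] := R3`. [folklore] -/
def P0 : List OpSpec :=
  [(.add, .dir 0, .dir 0, .imm 80), (.div, .ind 0, .dir 1, .imm 1), (.add, .dir 0, .dir 0, .imm 1),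
   (.div, .ind 0, .dir 2, .imm 1), (.add, .dir 0, .dir 0, .imm 1), (.div, .ind 0, .dir 3, .imm 1)]

/-- Phase 1: `R3 := R0 - 82 (= L); R1 := R3 + 36; R2 := R3 + 39; R0 := R2 + 40`. [folklore] -/
def P1 : List OpSpec :=
  [(.sub, .dir 3, .dir 0, .imm 82), (.add, .dir 1, .dir 3, .imm 36), (.add, .dir 2, .dir 3, .imm 39),
   (.add, .dir 0, .dir 2, .imm 40)]

/-- Phase 4: restore the saved cells into `M`-cells `1, 2, 3` and set `M`-cell `0 := L`:
`R35 := R3 + 80; mem[41] := mem[R35]; R35 += 1; mem[42] := mem[R35]; R35 += 1; mem[43] := mem[R35];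
mem[40] := R3`. [folklore] -/
def P4 : List OpSpec :=
  [(.add, .dir 35, .dir 3, .imm 80), (.div, .dir 41, .ind 35, .imm 1), (.add, .dir 35, .dir 35, .imm 1),
   (.div, .dir 42, .ind 35, .imm 1), (.add, .dir 35, .dir 35, .imm 1), (.div, .dir 43, .ind 35, .imm 1),
   (.div, .dir 40, .dir 3, .imm 1)]

/-- Phase 5: zero the save area: `R35 -= 2; mem[R35] := 0; R35 += 1; mem[R35] := 0; R35 += 1;
mem[R35] := 0`. [folklore] -/
def P5 : List OpSpec :=
  [(.sub, .dir 35, .dir 35, .imm 2), (.add, .ind 35, .imm 0, .imm 0), (.add, .dir 35, .dir 35, .imm 1),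
   (.add, .ind 35, .imm 0, .imm 0), (.add, .dir 35, .dir 35, .imm 1), (.add, .ind 35, .imm 0, .imm 0)]

/-- Phase 6: arguments of the width routine: `R16 := R3 (= L); R31 := 41`. [folklore] -/
def P6 : List OpSpec :=
  [(.div, .dir 16, .dir 3, .imm 1), (.div, .dir 31, .imm 41, .imm 1)]

/-- Phase 7: `R7 := R30 (= 2 ^ ws); R19 := 40; R20 := R16 + 1` (arguments of the reduction loop). [folklore] -/
def P7 : List OpSpec :=
  [(.div, .dir 7, .dir 30, .imm 1), (.div, .dir 19, .imm 40, .imm 1), (.add, .dir 20, .dir 16, .imm 1)]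

/-- Phase 8: environment registers: `R4 := 40; R5 := ((0 - 1) >>> 2) + 1 (= Q); R6 := 0;
R8 := R5 + R5; R9 := R8 + R5; R10 := 0`. [folklore] -/
def P8 : List OpSpec :=
  [(.div, .dir 4, .imm 40, .imm 1), (.sub, .dir 5, .imm 0, .imm 1), (.shr, .dir 5, .dir 5, .imm 2),
   (.add, .dir 5, .dir 5, .imm 1), (.div, .dir 6, .imm 0, .imm 1), (.add, .dir 8, .dir 5, .dir 5),
   (.add, .dir 9, .dir 8, .dir 5), (.div, .dir 10, .imm 0, .imm 1)]

/-- **The prologue** (88 instructions at position `0`; `k` = word-size constant of `M`). [folklore] -/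
def PRO (k : ℕ) : List Instr :=
  P0.map OpSpec.toInstr ++ P1.map OpSpec.toInstr ++ loopBlock 10 1 rdBody ++ P4.map OpSpec.toInstr ++
    P5.map OpSpec.toInstr ++ P6.map OpSpec.toInstr ++ widthCode 31 k ++ P7.map OpSpec.toInstr ++
    loopBlock 75 20 modBody ++ P8.map OpSpec.toInstr

/-- Length of `P0`. [folklore] -/
@[simp] theorem P0_length : P0.length = 6 := rfl
/-- Length of `P1`. [folklore] -/
@[simp] theorem P1_length : P1.length = 4 := rfl
/-- Length of `P4`. [folklore] -/
@[simp] theorem P4_length : P4.length = 7 := rfl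
/-- Length of `P5`. [folklore] -/
@[simp] theorem P5_length : P5.length = 6 := rfl
/-- Length of `P6`. [folklore] -/
@[simp] theorem P6_length : P6.length = 2 := rfl
/-- Length of `P7`. [folklore] -/
@[simp] theorem P7_length : P7.length = 3 := rfl
/-- Length of `P8`. [folklore] -/
@[simp] theorem P8_length : P8.length = 8 := rfl
/-- Length of the prologue `PRO` (88 instructions). [folklore] -/
@[simp] theorem PRO_length (k : ℕ) : (PRO k).length = 88 := by simp [PRO]

/-- Largest constant of `P0`. [folklore] -/
theorem opsMaxConst_P0 : opsMaxConst P0 = 80 := by decide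
/-- Largest constant of `P1`. [folklore] -/
theorem opsMaxConst_P1 : opsMaxConst P1 = 82 := by decide
/-- Largest constant of `P4`. [folklore] -/
theorem opsMaxConst_P4 : opsMaxConst P4 = 80 := by decide
/-- Largest constant of `P5`. [folklore] -/
theorem opsMaxConst_P5 : opsMaxConst P5 = 35 := by decide
/-- Largest constant of `P6`. [folklore] -/
theorem opsMaxConst_P6 : opsMaxConst P6 = 41 := by decide
/-- Largest constant of `P7`. [folklore] -/
theorem opsMaxConst_P7 : opsMaxConst P7 = 40 := by decide
/-- Largest constant of `P8`. [folklore] -/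
theorem opsMaxConst_P8 : opsMaxConst P8 = 40 := by decide

/-! ### The phases -/

/-- The memory after phase 0. [folklore] -/
def p0Mem (m : ℕ → ℕ) (L : ℕ) : ℕ → ℕ := fun a =>
  if a = 0 then L + 82 else if a = L + 80 then m 1 else if a = L + 81 then m 2
  else if a = L + 82 then m 3 else m a

/-- Semantics of prologue phase `P0` (save cells `1..3`). [folklore] -/
theorem execOps_P0 {W : ℕ} (m : ℕ → ℕ) {L : ℕ} (h0 : m 0 = L) (hL : L + 82 < 2 ^ W) :
    execOps W m P0 = p0Mem m L := by
  have n80 : L + 80 ≠ 0 := by omega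
  have n81 : L + 81 ≠ 0 := by omega
  have n82 : L + 82 ≠ 0 := by omega
  have n2 : (2 : ℕ) ≠ L + 80 := by omega
  have n3 : (3 : ℕ) ≠ L + 80 := by omega
  have n3' : (3 : ℕ) ≠ L + 81 := by omega
  simp only [P0, execOps_cons, execOps_nil, execOp_dir, execOp_ind, Operand.read_dir,
    Operand.read_imm, BinOp.eval, Nat.div_one, h0]
  simp (config := { decide := true }) only [Function.update_self, Function.update_of_ne, ne_eq,
    n2, n3, n3', Ne.symm n80, Ne.symm n81, not_false_eq_true,
    Nat.mod_eq_of_lt (show L + 80 < 2 ^ W by omega), Nat.mod_eq_of_lt (show L + 80 + 1 < 2 ^ W by omega),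
    Nat.mod_eq_of_lt (show L + 81 + 1 < 2 ^ W by omega), show L + 80 + 1 = L + 81 by rfl,
    show L + 81 + 1 = L + 82 by rfl]
  funext a
  simp only [p0Mem, Function.update_apply]
  split_ifs <;> omega

/-- Semantics of prologue phase `P1` (set up the save loop). [folklore] -/
theorem execOps_P1 {W : ℕ} (m : ℕ → ℕ) {L : ℕ} (h0 : m 0 = L + 82) (hL : L + 82 < 2 ^ W) :
    (execOps W m P1) 3 = L ∧ (execOps W m P1) 1 = L + 36 ∧ (execOps W m P1) 2 = L + 39 ∧
      (execOps W m P1) 0 = L + 79 ∧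
      ∀ a, a ≠ 0 → a ≠ 1 → a ≠ 2 → a ≠ 3 → (execOps W m P1) a = m a := by
  simp only [P1, execOps_cons, execOps_nil, execOp_dir, Operand.read_dir,
    Operand.read_imm, BinOp.eval, h0]
  have hsub : (L + 82 + 2 ^ W - 82 % 2 ^ W) % 2 ^ W = L := by
    rw [sub_eval_of_le (by omega) hL]; omega
  simp (config := { decide := true }) only [Function.update_self, Function.update_of_ne, ne_eq,
    hsub, Nat.mod_eq_of_lt (show L + 36 < 2 ^ W by omega),
    Nat.mod_eq_of_lt (show L + 39 < 2 ^ W by omega), Nat.mod_eq_of_lt (show L + 39 + 40 < 2 ^ W by omega)]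
  refine ⟨trivial, trivial, trivial, by trivial, fun a a0 a1 a2 a3 => ?_⟩
  simp (config := { decide := true }) only [Function.update_of_ne, ne_eq, a0, a1, a2, a3,
    not_false_eq_true]

/-- The memory after phase 4 (given `R3 = L`). [folklore] -/
def p4Mem (m : ℕ → ℕ) (L : ℕ) : ℕ → ℕ := fun a =>
  if a = 35 then L + 82 else if a = 40 then L else if a = 41 then m (L + 80)
  else if a = 42 then m (L + 81) else if a = 43 then m (L + 82) else m a

/-- Semantics of prologue phase `P4` (set up the relocation). [folklore] -/
theorem execOps_P4 {W : ℕ} (m : ℕ → ℕ) {L : ℕ} (h3 : m 3 = L) (hL : L + 82 < 2 ^ W) :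
    execOps W m P4 = p4Mem m L := by
  have n35 : L + 80 ≠ 35 := by omega
  have n41 : L + 81 ≠ 41 := by omega
  have n35' : L + 81 ≠ 35 := by omega
  have n42 : L + 82 ≠ 42 := by omega
  have n41' : L + 82 ≠ 41 := by omega
  have n35'' : L + 82 ≠ 35 := by omega
  simp only [P4, execOps_cons, execOps_nil, execOp_dir, Operand.read_dir,
    Operand.read_ind, Operand.read_imm, BinOp.eval, Nat.div_one, h3]
  simp (config := { decide := true }) only [Function.update_self, Function.update_of_ne, ne_eq,
    n35, n41, n35', n42, n41', n35'',
    not_false_eq_true,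
    Nat.mod_eq_of_lt (show L + 80 < 2 ^ W by omega), Nat.mod_eq_of_lt (show L + 80 + 1 < 2 ^ W by omega),
    Nat.mod_eq_of_lt (show L + 81 + 1 < 2 ^ W by omega), show L + 80 + 1 = L + 81 by rfl,
    show L + 81 + 1 = L + 82 by rfl]
  funext a
  simp only [p4Mem, Function.update_apply]
  split_ifs <;> omega

/-- The memory after phase 5 (given `R35 = L + 82`). [folklore] -/
def p5Mem (m : ℕ → ℕ) (L : ℕ) : ℕ → ℕ := fun a =>
  if a = L + 80 then 0 else if a = L + 81 then 0 else if a = L + 82 then 0 else m a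

/-- Semantics of prologue phase `P5` (restore the saved cells). [folklore] -/
theorem execOps_P5 {W : ℕ} (m : ℕ → ℕ) {L : ℕ} (h35 : m 35 = L + 82) (hL : L + 82 < 2 ^ W) :
    execOps W m P5 = p5Mem m L := by
  have n35 : L + 80 ≠ 35 := by omega
  have n35' : L + 81 ≠ 35 := by omega
  have n35'' : L + 82 ≠ 35 := by omega
  have hsub : (L + 82 + 2 ^ W - 2 % 2 ^ W) % 2 ^ W = L + 80 := by
    rw [sub_eval_of_le (by omega) hL]; omega
  simp only [P5, execOps_cons, execOps_nil, execOp_dir, execOp_ind, Operand.read_dir,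
    Operand.read_imm, BinOp.eval, h35]
  simp (config := { decide := true }) only [Function.update_self, Function.update_of_ne, ne_eq,
    Ne.symm n35, Ne.symm n35', not_false_eq_true, hsub,
    Nat.zero_mod, Nat.add_zero,
    Nat.mod_eq_of_lt (show L + 80 + 1 < 2 ^ W by omega),
    Nat.mod_eq_of_lt (show L + 81 + 1 < 2 ^ W by omega), show L + 80 + 1 = L + 81 by rfl,
    show L + 81 + 1 = L + 82 by rfl]
  funext a
  simp only [p5Mem, Function.update_apply]
  split_ifs <;> subst_vars <;> omega

/-- Semantics of prologue phase `P6` (set up the width computation). [folklore] -/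
theorem execOps_P6 {W : ℕ} (m : ℕ → ℕ) :
    (execOps W m P6) 16 = m 3 ∧ (execOps W m P6) 31 = 41 ∧
      ∀ a, a ≠ 16 → a ≠ 31 → (execOps W m P6) a = m a := by
  simp only [P6, execOps_cons, execOps_nil, execOp_dir, Operand.read_dir,
    Operand.read_imm, BinOp.eval, Nat.div_one]
  simp (config := { decide := true }) only [Function.update_self, Function.update_of_ne, ne_eq]
  refine ⟨trivial, trivial, fun a a16 a31 => ?_⟩
  simp (config := { decide := true }) only [Function.update_of_ne, ne_eq, a16, a31, not_false_eq_true]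

/-- Semantics of prologue phase `P7` (set up the reduction loop). [folklore] -/
theorem execOps_P7 {W : ℕ} (m : ℕ → ℕ) (h16 : m 16 + 1 < 2 ^ W) :
    (execOps W m P7) 7 = m 30 ∧ (execOps W m P7) 19 = 40 ∧ (execOps W m P7) 20 = m 16 + 1 ∧
      ∀ a, a ≠ 7 → a ≠ 19 → a ≠ 20 → (execOps W m P7) a = m a := by
  simp only [P7, execOps_cons, execOps_nil, execOp_dir, Operand.read_dir,
    Operand.read_imm, BinOp.eval, Nat.div_one]
  simp (config := { decide := true }) only [Function.update_self, Function.update_of_ne, ne_eq,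
    Nat.mod_eq_of_lt h16]
  refine ⟨trivial, trivial, trivial, fun a a7 a19 a20 => ?_⟩
  simp (config := { decide := true }) only [Function.update_of_ne, ne_eq, a7, a19, a20,
    not_false_eq_true]

/-- Semantics of prologue phase `P8` (environment registers). [folklore] -/
theorem execOps_P8 {W : ℕ} (m : ℕ → ℕ) (hW : 8 ≤ W) :
    (execOps W m P8) 4 = 40 ∧ (execOps W m P8) 5 = Qv W ∧ (execOps W m P8) 6 = 0 ∧
      (execOps W m P8) 8 = 2 * Qv W ∧ (execOps W m P8) 9 = 3 * Qv W ∧ (execOps W m P8) 10 = 0 ∧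
      ∀ a, a ≠ 4 → a ≠ 5 → a ≠ 6 → a ≠ 8 → a ≠ 9 → a ≠ 10 → (execOps W m P8) a = m a := by
  have h4 := four_mul_Qv (show 2 ≤ W by omega)
  have hQ := Qv_ge hW
  have h1 : (1 : ℕ) % 2 ^ W = 1 := Nat.mod_eq_of_lt (by omega)
  have hsub : (0 + 2 ^ W - 1) % 2 ^ W = 2 ^ W - 1 := by
    rw [Nat.zero_add, Nat.mod_eq_of_lt (by omega)]
  have hshr : (2 ^ W - 1) >>> 2 = Qv W - 1 := by
    rw [Nat.shiftRight_eq_div_pow]; omega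
  have hQ1 : (Qv W - 1 + 1) % 2 ^ W = Qv W := by rw [Nat.mod_eq_of_lt (by omega)]; omega
  have h2Q : (Qv W + Qv W) % 2 ^ W = 2 * Qv W := by rw [Nat.mod_eq_of_lt (by omega)]; omega
  have h3Q : (2 * Qv W + Qv W) % 2 ^ W = 3 * Qv W := by rw [Nat.mod_eq_of_lt (by omega)]; omega
  simp only [P8, execOps_cons, execOps_nil, execOp_dir, Operand.read_dir,
    Operand.read_imm, BinOp.eval, Nat.div_one]
  simp (config := { decide := true }) only [Function.update_self, Function.update_of_ne, ne_eq,
    h1, hsub, hshr, hQ1, h2Q, h3Q]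
  refine ⟨trivial, trivial, trivial, trivial, trivial, trivial, fun a a4 a5 a6 a8 a9 a10 => ?_⟩
  simp (config := { decide := true }) only [Function.update_of_ne, ne_eq, a4, a5, a6, a8, a9, a10,
    not_false_eq_true]

/-! ### Initial memories -/

/-- The initial memory at a smaller word size is the initial memory reduced. [folklore] -/
theorem init_mem_mod {W ws : ℕ} (hws : ws ≤ W) (x : List ℕ) (i : ℕ) :
    (init W x).mem i % 2 ^ ws = (init ws x).mem i := by
  have hdvd : 2 ^ ws ∣ 2 ^ W := Nat.pow_dvd_pow 2 hws
  rcases i with _ | j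
  · rw [init_mem_zero, init_mem_zero, Nat.mod_mod_of_dvd _ hdvd]
  · rcases Nat.lt_or_ge j x.length with hj | hj
    · rw [init_mem_succ _ _ _ hj, init_mem_succ _ _ _ hj, Nat.mod_mod_of_dvd _ hdvd]
    · rw [init_mem_of_length_lt _ _ _ (by omega), init_mem_of_length_lt _ _ _ (by omega), Nat.zero_mod]

/-- At word size `W ≥ inputWidth x` the input is stored exactly. [folklore] -/
theorem init_mem_succ_exact {W : ℕ} {x : List ℕ} (hw : inputWidth x ≤ W) {j : ℕ} (hj : j < x.length) :
    (init W x).mem (j + 1) = x[j] := by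
  rw [init_mem_succ _ _ _ hj, Nat.mod_eq_of_lt]
  exact lt_of_lt_of_le (lt_two_pow_inputWidth_of_mem x _ (List.getElem_mem hj))
    (Nat.pow_le_pow_right (by norm_num) hw)

/-- The cost of the prologue on an input of length `L` at word size `W`. [folklore] -/
def proCost (L W : ℕ) : ℕ := 11 * L + widthCost L W + 260

/-- **Specification of the prologue.** From `init W x` (`W ≥ 8`, `inputWidth x ≤ W`,
`k * inputWidth x < W`, `|x| + 83 ≤ Q`), the prologue placed at `0` reaches position `88` within
`proCost |x| W` steps; afterwards the `M`-region (cells `40 + i`, `i < Q - 40`) holds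
`init (k * inputWidth x) x`, everything from `Q` upwards is still `0`, the environment registers
`4, …, 10` hold `40, Q, 0, 2 ^ (k * inputWidth x)` and `2Q, 3Q, 0`, and all cells are words.
[folklore] -/
theorem run_PRO {P : Program} {W k : ℕ} {O : List ℕ → List ℕ} {ρ : ℕ → ℕ} {x : List ℕ}
    (hcode : CodeAt P 0 (PRO k)) (hw : inputWidth x ≤ W) (hk : k * inputWidth x < W)
    (hL : x.length + 83 ≤ Qv W) :
    ∃ n, n ≤ proCost x.length W ∧ ∃ mem' : ℕ → ℕ,
      run P W O ρ n (init W x) = some ⟨some 88, mem', 0, []⟩ ∧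
      (∀ i, i < Qv W - 40 → mem' (40 + i) = (init (k * inputWidth x) x).mem i) ∧
      (∀ a, Qv W ≤ a → mem' a = 0) ∧
      mem' 4 = 40 ∧ mem' 5 = Qv W ∧ mem' 6 = 0 ∧ mem' 7 = 2 ^ (k * inputWidth x) ∧
      mem' 8 = 2 * Qv W ∧ mem' 9 = 3 * Qv W ∧ mem' 10 = 0 ∧
      ∀ a, mem' a < 2 ^ W := by
  -- code placement
  simp only [PRO] at hcode
  obtain ⟨hc0, hc9⟩ := codeAt_append_iff.1 hcode
  obtain ⟨hc0, hc8⟩ := codeAt_append_iff.1 hc0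
  obtain ⟨hc0, hc7⟩ := codeAt_append_iff.1 hc0
  obtain ⟨hc0, hc6⟩ := codeAt_append_iff.1 hc0
  obtain ⟨hc0, hc5⟩ := codeAt_append_iff.1 hc0
  obtain ⟨hc0, hc4⟩ := codeAt_append_iff.1 hc0
  obtain ⟨hc0, hc3⟩ := codeAt_append_iff.1 hc0
  obtain ⟨hc0, hc2⟩ := codeAt_append_iff.1 hc0
  obtain ⟨hc0, hc1⟩ := codeAt_append_iff.1 hc0
  simp only [List.length_append, List.length_map, loopBlock_length, P0_length, P1_length,
    rdBody_length, P4_length, P5_length, P6_length, widthCode_length, P7_length, modBody_length,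
    Nat.reduceAdd, Nat.zero_add] at hc1 hc2 hc3 hc4 hc5 hc6 hc7 hc8 hc9
  -- constants
  have hW : 8 ≤ W := eight_le_of_Qv (by omega)
  have h4Q := four_mul_Qv (show 2 ≤ W by omega)
  have hQ := Qv_ge hW
  have h255 : 255 ≤ 2 ^ W - 1 := by
    have : 2 ^ 8 ≤ 2 ^ W := Nat.pow_le_pow_right (by norm_num) hW
    omega
  have hV1 : 1 ≤ 2 ^ W - 1 := by omega
  set L := x.length with hLdef
  set ws := k * inputWidth x with hws
  have hwsW : ws ≤ W := hk.le
  have hLW : L + 82 < 2 ^ W := by omega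
  set m0 := (init W x).mem with hm0
  have hm00 : m0 0 = L := init_mem_zero_of_inputWidth_le hw
  have hm0hi : ∀ a, L < a → m0 a = 0 := fun a ha => init_mem_of_length_lt _ _ _ ha
  have hb0 : MemLE (2 ^ W - 1) m0 := init_memLE W x le_rfl
  -- phase 0 (6 steps)
  have e1 := execOps_P0 (W := W) m0 hm00 hLW
  have r1 := run_ops (P := P) (w := W) (O := O) (ρ := ρ) P0 hc0 (c := init W x) rfl
  rw [show (init W x).mem = m0 from rfl, e1] at r1
  set m1 := p0Mem m0 L with hm1
  have hb1 : MemLE (2 ^ W - 1) m1 := by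
    rw [← e1]; exact execOps_memLE_of_opsMaxConst le_rfl hV1 (by rw [opsMaxConst_P0]; omega) hb0
  -- phase 1 (4 steps)
  obtain ⟨a3, a1, a2, a0, af⟩ := execOps_P1 (W := W) m1 (by simp [hm1, p0Mem]) hLW
  have r2 := run_ops (P := P) (w := W) (O := O) (ρ := ρ) P1 hc1 (c := ⟨some 6, m1, 0, []⟩) rfl
  set m2 := execOps W m1 P1 with hm2
  have hb2 : MemLE (2 ^ W - 1) m2 :=
    execOps_memLE_of_opsMaxConst le_rfl hV1 (by rw [opsMaxConst_P1]; omega) hb1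
  -- phase 2: relocation loop, `L + 36` rounds
  have hrd := iterate_rdBody (W := W) (mem := m2) (s₀ := L + 39) (n := L + 36) (by omega) (by omega)
    a2 (by rw [a0]) a1
  have r3 := run_while (P := P) (w := W) (O := O) (ρ := ρ) hc2 (L + 36) (c := ⟨some 10, m2, 0, []⟩)
    rfl
    (fun j hj => by
      show ((fun m => execOps W m rdBody)^[j] m2) 1 ≠ 0
      rw [hrd j hj.le]
      show (if (1:ℕ) = 0 then L + 39 + 40 - j else if (1:ℕ) = 2 then L + 39 - j
        else if (1:ℕ) = 1 then L + 36 - j else _) ≠ 0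
      rw [if_neg (by decide), if_neg (by decide), if_pos rfl]; omega)
    (by
      show ((fun m => execOps W m rdBody)^[L + 36] m2) 1 = 0
      rw [hrd _ le_rfl]
      show (if (1:ℕ) = 0 then L + 39 + 40 - (L + 36) else if (1:ℕ) = 2 then L + 39 - (L + 36)
        else if (1:ℕ) = 1 then L + 36 - (L + 36) else _) = 0
      rw [if_neg (by decide), if_neg (by decide), if_pos rfl]; omega)
  simp only [] at r3
  rw [hrd _ le_rfl] at r3
  set m3 := rdMem m2 (L + 39) (L + 36) (L + 36) with hm3
  have hb3 : MemLE (2 ^ W - 1) m3 := by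
    rw [hm3, ← hrd _ le_rfl]
    exact iterate_execOps_memLE le_rfl hV1 (by rw [opsMaxConst_rdBody]; omega) _ hb2
  have hm3v : ∀ a, m3 a = if a = 0 then 43 else if a = 2 then 3 else if a = 1 then 0
      else if 43 < a ∧ a ≤ L + 79 then m2 (a - 40) else m2 a := by
    intro a
    simp only [hm3, rdMem]
    by_cases h0 : a = 0
    · simp [h0]
    · simp only [h0, if_false]
      by_cases h2 : a = 2
      · simp [h2]
      · simp only [h2, if_false]
        by_cases h1 : a = 1
        · simp [h1]
        · simp only [h1, if_false]
          by_cases hr : 43 < a ∧ a ≤ L + 79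
          · rw [if_pos (by omega), if_pos hr]
          · rw [if_neg (by omega), if_neg hr]
  have hm3_3 : m3 3 = L := by
    rw [hm3v]; simp only [show (3:ℕ) ≠ 0 by decide, show (3:ℕ) ≠ 2 by decide, show (3:ℕ) ≠ 1 by decide,
      if_false, show ¬ (43 < 3 ∧ 3 ≤ L + 79) by omega]
    exact a3
  -- phase 4 (7 steps)
  have e4 := execOps_P4 (W := W) m3 hm3_3 hLW
  have r4 := run_ops (P := P) (w := W) (O := O) (ρ := ρ) P4 hc3 (c := ⟨some 16, m3, 0, []⟩) rfl
  simp only [] at r4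
  rw [e4] at r4
  set m4 := p4Mem m3 L with hm4
  have hb4 : MemLE (2 ^ W - 1) m4 := by
    rw [← e4]; exact execOps_memLE_of_opsMaxConst le_rfl hV1 (by rw [opsMaxConst_P4]; omega) hb3
  -- phase 5 (6 steps)
  have e5 := execOps_P5 (W := W) m4 (by simp [hm4, p4Mem]) hLW
  have r5 := run_ops (P := P) (w := W) (O := O) (ρ := ρ) P5 hc4 (c := ⟨some 23, m4, 0, []⟩) rfl
  simp only [] at r5
  rw [e5] at r5
  set m5 := p5Mem m4 L with hm5
  have hb5 : MemLE (2 ^ W - 1) m5 := by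
    rw [← e5]; exact execOps_memLE_of_opsMaxConst le_rfl hV1 (by rw [opsMaxConst_P5]; omega) hb4
  -- the M-region now holds the input, relocated by 40
  have hM5 : ∀ a, 40 ≤ a → m5 a = m0 (a - 40) := by
    intro a ha
    have h1a : ∀ b, b ≠ 0 → b ≠ L + 80 → b ≠ L + 81 → b ≠ L + 82 → m1 b = m0 b := by
      intro b b0 b1 b2 b3; simp only [hm1, p0Mem, b0, b1, b2, b3, if_false]
    simp only [hm5, p5Mem]
    by_cases h80 : a = L + 80
    · rw [if_pos h80, hm0hi _ (by omega)]
    rw [if_neg h80]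
    by_cases h81 : a = L + 81
    · rw [if_pos h81, hm0hi _ (by omega)]
    rw [if_neg h81]
    by_cases h82 : a = L + 82
    · rw [if_pos h82, hm0hi _ (by omega)]
    rw [if_neg h82]
    simp only [hm4, p4Mem, show a ≠ 35 by omega, if_false]
    by_cases h40 : a = 40
    · rw [if_pos h40, h40, Nat.sub_self, hm00]
    rw [if_neg h40]
    have hsave : ∀ j, j = 0 ∨ j = 1 ∨ j = 2 → m3 (L + 80 + j) = m0 (j + 1) := by
      intro j hj
      rw [hm3v, if_neg (by omega), if_neg (by omega), if_neg (by omega), if_neg (by omega),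
        af _ (by omega) (by omega) (by omega) (by omega)]
      simp only [hm1, p0Mem]
      rcases hj with rfl | rfl | rfl
      · simp []
      · simp []
      · simp []
    by_cases h41 : a = 41
    · rw [if_pos h41, h41]; exact hsave 0 (by simp)
    rw [if_neg h41]
    by_cases h42 : a = 42
    · rw [if_pos h42, h42]; exact hsave 1 (by simp)
    rw [if_neg h42]
    by_cases h43 : a = 43
    · rw [if_pos h43, h43]; exact hsave 2 (by simp)
    rw [if_neg h43, hm3v, if_neg (by omega), if_neg (by omega), if_neg (by omega)]
    by_cases hr : 43 < a ∧ a ≤ L + 79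
    · rw [if_pos hr, af _ (by omega) (by omega) (by omega) (by omega),
        h1a _ (by omega) (by omega) (by omega) (by omega)]
    · rw [if_neg hr, af _ (by omega) (by omega) (by omega) (by omega),
        h1a _ (by omega) (by omega) (by omega) (by omega), hm0hi _ (by omega), hm0hi _ (by omega)]
  have hm5_3 : m5 3 = L := by
    simp only [hm5, p5Mem, hm4, p4Mem]
    rw [if_neg (by omega), if_neg (by omega), if_neg (by omega)]
    simp only [show (3:ℕ) ≠ 35 by decide, show (3:ℕ) ≠ 40 by decide, show (3:ℕ) ≠ 41 by decide,
      show (3:ℕ) ≠ 42 by decide, show (3:ℕ) ≠ 43 by decide, if_false]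
    exact hm3_3
  -- phase 6 (2 steps)
  obtain ⟨g16, g31, gf⟩ := execOps_P6 (W := W) m5
  have r6 := run_ops (P := P) (w := W) (O := O) (ρ := ρ) P6 hc5 (c := ⟨some 29, m5, 0, []⟩) rfl
  simp only [] at r6
  set m6 := execOps W m5 P6 with hm6
  have hb6 : MemLE (2 ^ W - 1) m6 :=
    execOps_memLE_of_opsMaxConst le_rfl hV1 (by rw [opsMaxConst_P6]; omega) hb5
  have hseg : readSeg m6 41 L = x := by
    apply List.ext_getElem (by simp [hLdef])
    intro j hj _
    simp only [readSeg, List.getElem_map, List.getElem_range]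
    rw [gf _ (by omega) (by omega), hM5 _ (by omega), show 41 + j - 40 = j + 1 by omega]
    exact init_mem_succ_exact hw (by rw [readSeg_length] at hj; exact hj)
  -- width routine
  obtain ⟨n7, hn7, m7, r7, o30, -, o_frame, hb7⟩ := run_widthCode (P := P) (W := W) (O := O) (ρ := ρ)
    (i₀ := 31) (kk := k) hc6 (c := ⟨some 31, m6, 0, []⟩) rfl
    (fun a => by have := hb6 a; simp only at this ⊢; omega) (p := 41) (L := L)
    (by simp only; rw [g16, hm5_3]) (by simp only; rw [g31]) (by omega) (by omega)
    (by simp only; rw [hseg]; exact hk)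
  simp only [] at r7 o30 o_frame
  rw [hseg] at o30
  -- phase 7 (3 steps)
  have h16 : m7 16 = L := by rw [o_frame _ (by omega), g16, hm5_3]
  obtain ⟨i7, i19, i20, i_f⟩ := execOps_P7 (W := W) m7 (by rw [h16]; omega)
  have r8 := run_ops (P := P) (w := W) (O := O) (ρ := ρ) P7 hc7 (c := ⟨some 72, m7, 0, []⟩) rfl
  simp only [] at r8
  set m8 := execOps W m7 P7 with hm8
  have hb8 : MemLE (2 ^ W - 1) m8 :=
    execOps_memLE_of_opsMaxConst le_rfl hV1 (by rw [opsMaxConst_P7]; omega) (fun a => by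
      have := hb7 a; omega)
  -- reduction loop, `L + 1` rounds
  have hmod := iterate_modBody (W := W) (mem := m8) (P := 2 ^ ws) (p₀ := 40) (n := L + 1) le_rfl
    (by omega) (by rw [i7, o30]) i19 (by rw [i20, h16])
  have r9 := run_while (P := P) (w := W) (O := O) (ρ := ρ) hc8 (L + 1) (c := ⟨some 75, m8, 0, []⟩) rfl
    (fun j hj => by
      show ((fun m => execOps W m modBody)^[j] m8) 20 ≠ 0
      rw [hmod j hj.le]
      show (if (20:ℕ) = 19 then 40 + j else if (20:ℕ) = 20 then L + 1 - j else _) ≠ 0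
      rw [if_neg (by decide), if_pos rfl]; omega)
    (by
      show ((fun m => execOps W m modBody)^[L + 1] m8) 20 = 0
      rw [hmod _ le_rfl]
      show (if (20:ℕ) = 19 then 40 + (L + 1) else if (20:ℕ) = 20 then L + 1 - (L + 1) else _) = 0
      rw [if_neg (by decide), if_pos rfl]; omega)
  simp only [] at r9
  rw [hmod _ le_rfl] at r9
  set m9 := modMem m8 (2 ^ ws) 40 (L + 1) (L + 1) with hm9
  have hb9 : MemLE (2 ^ W - 1) m9 := by
    rw [hm9, ← hmod _ le_rfl]
    exact iterate_execOps_memLE le_rfl hV1 (by rw [opsMaxConst_modBody]; omega) _ hb8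
  -- phase 8 (8 steps)
  obtain ⟨j4, j5, j6, j8, j9, j10, jf⟩ := execOps_P8 (W := W) m9 hW
  have r10 := run_ops (P := P) (w := W) (O := O) (ρ := ρ) P8 hc9 (c := ⟨some 80, m9, 0, []⟩) rfl
  simp only [] at r10
  set m10 := execOps W m9 P8 with hm10
  have hb10 : MemLE (2 ^ W - 1) m10 :=
    execOps_memLE_of_opsMaxConst le_rfl hV1 (by rw [opsMaxConst_P8]; omega) hb9
  -- values above the registers
  have hhigh : ∀ a, 40 ≤ a → m10 a = if a ≤ 40 + L then m0 (a - 40) % 2 ^ ws else m0 (a - 40) := by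
    intro a ha
    rw [jf _ (by omega) (by omega) (by omega) (by omega) (by omega) (by omega)]
    simp only [hm9, modMem]
    rw [if_neg (by omega), if_neg (by omega)]
    have h87 : m8 a = m0 (a - 40) := by
      rw [i_f _ (by omega) (by omega) (by omega), o_frame _ (by omega), gf _ (by omega) (by omega),
        hM5 _ ha]
    by_cases hr : a ≤ 40 + L
    · rw [if_pos (by omega), if_pos hr, h87]
    · rw [if_neg (by omega), if_neg hr, h87]
  -- normalise the run segments and assemble
  simp only [P0_length, P1_length, rdBody_length, P4_length, P5_length, P6_length, P7_length,
    modBody_length, P8_length, Nat.reduceAdd, Nat.zero_add] at r1 r2 r3 r4 r5 r6 r8 r9 r10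
  refine ⟨6 + (4 + (((L + 36) * 6 + 1) + (7 + (6 + (2 + (n7 + (3 + (((L + 1) * 5 + 1) + 8)))))))),
    by simp only [proCost]; omega, m10, ?_, ?_, ?_, j4, j5, j6, ?_, j8, j9, j10, ?_⟩
  · exact run_add_of_run _ _ _ _ r1 (run_add_of_run _ _ _ _ r2 (run_add_of_run _ _ _ _ r3
      (run_add_of_run _ _ _ _ r4 (run_add_of_run _ _ _ _ r5 (run_add_of_run _ _ _ _ r6
      (run_add_of_run _ _ _ _ r7 (run_add_of_run _ _ _ _ r8 (run_add_of_run _ _ _ _ r9 r10))))))))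
  · -- the M-region holds `init ws x`
    intro i hi
    rw [hhigh _ (by omega), show 40 + i - 40 = i by omega]
    by_cases hiL : i ≤ L
    · rw [if_pos (by omega)]; exact init_mem_mod hwsW x i
    · rw [if_neg (by omega), hm0hi _ (by omega)]
      exact (init_mem_of_length_lt _ _ _ (by omega)).symm
  · -- above `Q` everything is still zero
    intro a ha
    rw [hhigh _ (by omega), if_neg (by omega), hm0hi _ (by omega)]
  · rw [jf _ (by omega) (by omega) (by omega) (by omega) (by omega) (by omega)]
    simp only [hm9, modMem]
    rw [if_neg (by omega), if_neg (by omega), if_neg (by omega), i7, o30]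
  · intro a; have := hb10 a; omega

/-! ## The epilogue -/

/-- Epilogue, phase 0 set-up: `R33 := R8 (= 2Q); R19 := 40; R20 := 40` (save `M`-cells `0 … 39`
to `2Q …` by the ascending copy loop). [folklore] -/
def E0 : List OpSpec :=
  [(.div, .dir 33, .dir 8, .imm 1), (.div, .dir 19, .imm 40, .imm 1), (.div, .dir 20, .imm 40, .imm 1)]

/-- Epilogue, phase 1 set-up: `R20 := mem[40] + 1 (= ℓ + 1); R19 := 80; R33 := 40` (copy
`M`-cells `40 … 40 + ℓ` down to cells `40 … 40 + ℓ`). [folklore] -/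
def E1 : List OpSpec :=
  [(.add, .dir 20, .dir 40, .imm 1), (.div, .dir 19, .imm 80, .imm 1), (.div, .dir 33, .imm 40, .imm 1)]

/-- Epilogue, phase 2 middle part: for `i = 1 … n`: `mem[i] := mem[R0]; R0 += 1` (unrolled: the
registers are being overwritten, only cell `0` serves as a pointer). [folklore] -/
def E2mid : ℕ → List OpSpec
  | 0 => []
  | i + 1 => E2mid i ++ [(.div, .dir (i + 1), .ind 0, .imm 1), (.add, .dir 0, .dir 0, .imm 1)]

/-- Epilogue, phase 2: `R0 := R8 + 1; E2mid 39; R0 -= 40; mem[0] := mem[R0]`. [folklore] -/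
def E2 : List OpSpec :=
  [(.add, .dir 0, .dir 8, .imm 1)] ++ E2mid 39 ++ [(.sub, .dir 0, .dir 0, .imm 40), (.div, .dir 0, .ind 0, .imm 1)]

/-- **The epilogue** at position `pos` (100 instructions, ending with `halt`). [folklore] -/
def EPI (pos : ℕ) : List Instr :=
  E0.map OpSpec.toInstr ++ loopBlock (pos + 3) 20 cuBody ++ E1.map OpSpec.toInstr ++
    loopBlock (pos + 12) 20 cuBody ++ E2.map OpSpec.toInstr ++ [.halt]

/-- Length of `E0`. [folklore] -/
@[simp] theorem E0_length : E0.length = 3 := rfl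
/-- Length of `E1`. [folklore] -/
@[simp] theorem E1_length : E1.length = 3 := rfl
/-- Length of `E2mid n`. [folklore] -/
@[simp] theorem E2mid_length (n : ℕ) : (E2mid n).length = 2 * n := by
  induction n with
  | zero => rfl
  | succ n ih => simp [E2mid, ih]; omega
/-- Length of `E2`. [folklore] -/
@[simp] theorem E2_length : E2.length = 81 := by simp [E2]
/-- Length of the epilogue `EPI` (100 instructions). [folklore] -/
@[simp] theorem EPI_length (pos : ℕ) : (EPI pos).length = 100 := by simp [EPI]

/-- Semantics of epilogue phase `E0` (set up the save loop). [folklore] -/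
theorem execOps_E0 {W : ℕ} (m : ℕ → ℕ) :
    (execOps W m E0) 33 = m 8 ∧ (execOps W m E0) 19 = 40 ∧ (execOps W m E0) 20 = 40 ∧
      ∀ a, a ≠ 19 → a ≠ 20 → a ≠ 33 → (execOps W m E0) a = m a := by
  simp only [E0, execOps_cons, execOps_nil, execOp_dir, Operand.read_dir,
    Operand.read_imm, BinOp.eval, Nat.div_one]
  simp (config := { decide := true }) only [Function.update_self, Function.update_of_ne, ne_eq]
  refine ⟨trivial, trivial, trivial, fun a a19 a20 a33 => ?_⟩
  simp (config := { decide := true }) only [Function.update_of_ne, ne_eq, a19, a20, a33, not_false_eq_true]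

/-- Semantics of epilogue phase `E1` (set up the restore loop). [folklore] -/
theorem execOps_E1 {W : ℕ} (m : ℕ → ℕ) (h40 : m 40 + 1 < 2 ^ W) :
    (execOps W m E1) 20 = m 40 + 1 ∧ (execOps W m E1) 19 = 80 ∧ (execOps W m E1) 33 = 40 ∧
      ∀ a, a ≠ 19 → a ≠ 20 → a ≠ 33 → (execOps W m E1) a = m a := by
  simp only [E1, execOps_cons, execOps_nil, execOp_dir, Operand.read_dir,
    Operand.read_imm, BinOp.eval, Nat.div_one]
  simp (config := { decide := true }) only [Function.update_self, Function.update_of_ne, ne_eq,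
    Nat.mod_eq_of_lt h40]
  refine ⟨trivial, trivial, trivial, fun a a19 a20 a33 => ?_⟩
  simp (config := { decide := true }) only [Function.update_of_ne, ne_eq, a19, a20, a33, not_false_eq_true]

/-- The unrolled restore: from cell `0 = H + 1` (`H ≥ 40`, `H + 40 < 2 ^ W`), after `E2mid n`
(`n ≤ 39`) cell `0` holds `H + 1 + n`, cells `1 … n` hold `m (H + 1) … m (H + n)`, and nothing else
has changed. [folklore] -/
theorem execOps_E2mid {W : ℕ} (m : ℕ → ℕ) {H : ℕ} (hH : 40 ≤ H) (hHW : H + 40 < 2 ^ W)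
    (h0 : m 0 = H + 1) : ∀ n, n ≤ 39 →
      execOps W m (E2mid n) = fun a => if a = 0 then H + 1 + n else if 1 ≤ a ∧ a ≤ n then m (H + a) else m a
  | 0, _ => by
      funext a
      simp only [E2mid, execOps_nil, Nat.add_zero]
      split_ifs with h1 h2
      · rw [h1, h0]
      · omega
      · rfl
  | n + 1, hn => by
      rw [E2mid, execOps_append, execOps_E2mid m hH hHW h0 n (by omega)]
      simp only [execOps_cons, execOps_nil, execOp_dir, Operand.read_dir, Operand.read_ind,
        Operand.read_imm, BinOp.eval, Nat.div_one]
      funext a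
      simp only [Function.update_apply]
      -- evaluate the reads
      have hn0 : (n + 1 = 0) = False := by simp
      simp only [if_true, if_false, show ¬ (1 ≤ 0 ∧ 0 ≤ n) by omega,
        show ¬ (H + 1 + n = 0) by omega, show ¬ (1 ≤ H + 1 + n ∧ H + 1 + n ≤ n) by omega,
        show (0 : ℕ) = n + 1 ↔ False by simp, Nat.mod_eq_of_lt (show H + 1 + n + 1 < 2 ^ W by omega)]
      by_cases ha0 : a = 0
      · simp [ha0]; omega
      simp only [ha0, if_false]
      by_cases ha : a = n + 1
      · subst ha
        simp only [if_true, show 1 ≤ n + 1 ∧ n + 1 ≤ n + 1 from ⟨by omega, le_rfl⟩]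
        congr 1; omega
      simp only [ha, if_false]
      by_cases hr : 1 ≤ a ∧ a ≤ n
      · rw [if_pos hr, if_pos ⟨hr.1, by omega⟩]
      · rw [if_neg hr, if_neg (fun h => hr ⟨h.1, by omega⟩)]

/-- The whole of phase 2: with `H = m 8 ≥ 40`, `H + 40 < 2 ^ W`, afterwards cell `0` holds `m H`,
cells `1 … 39` hold `m (H + 1) … m (H + 39)`, and cells `≥ 40` are unchanged. [folklore] -/
theorem execOps_E2 {W : ℕ} (m : ℕ → ℕ) {H : ℕ} (h8 : m 8 = H) (hH : 40 ≤ H) (hHW : H + 40 < 2 ^ W) :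
    (execOps W m E2) 0 = m H ∧ (∀ a, 1 ≤ a → a ≤ 39 → (execOps W m E2) a = m (H + a)) ∧
      ∀ a, 40 ≤ a → (execOps W m E2) a = m a := by
  rw [E2, execOps_append, execOps_append]
  set m₁ := execOps W m [(.add, .dir 0, .dir 8, .imm 1)] with hm₁
  have hm₁v : m₁ = Function.update m 0 (H + 1) := by
    simp only [hm₁, execOps_cons, execOps_nil, execOp_dir, Operand.read_dir, Operand.read_imm,
      BinOp.eval, h8, Nat.mod_eq_of_lt (show H + 1 < 2 ^ W by omega)]
  have hmid := execOps_E2mid (W := W) m₁ hH hHW (by rw [hm₁v, Function.update_self]) 39 le_rfl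
  rw [hmid]
  set m₂ : ℕ → ℕ := fun a => if a = 0 then H + 1 + 39 else if 1 ≤ a ∧ a ≤ 39 then m₁ (H + a) else m₁ a
    with hm₂
  have hm₂0 : m₂ 0 = H + 40 := by simp [hm₂]
  have hm₁H : ∀ b, 40 ≤ b → m₁ b = m b := fun b hb => by
    rw [hm₁v, Function.update_of_ne (by omega)]
  simp only [execOps_cons, execOps_nil, execOp_dir, Operand.read_dir, Operand.read_ind,
    Operand.read_imm, BinOp.eval, Nat.div_one, hm₂0]
  have hsub : (H + 40 + 2 ^ W - 40 % 2 ^ W) % 2 ^ W = H := by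
    rw [sub_eval_of_le (by omega) hHW]; omega
  simp only [hsub, Function.update_self]
  refine ⟨?_, fun a ha1 ha39 => ?_, fun a ha => ?_⟩
  · simp only [Function.update_apply, show H ≠ 0 by omega, if_false, hm₂,
      show ¬ (1 ≤ H ∧ H ≤ 39) by omega]
    exact hm₁H _ hH
  · simp only [Function.update_apply, show a ≠ 0 by omega, if_false, hm₂,
      show (1 ≤ a ∧ a ≤ 39) by exact ⟨ha1, ha39⟩]
    exact hm₁H _ (by omega)
  · simp only [Function.update_apply, show a ≠ 0 by omega, if_false, hm₂,
      show ¬ (1 ≤ a ∧ a ≤ 39) by omega]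
    exact hm₁H _ ha

/-- The cost of the epilogue for an output of length `ℓ`. [folklore] -/
def epiCost (ℓ : ℕ) : ℕ := 6 * ℓ + 340

/-- **Specification of the epilogue.** Placed at `pos` and started at `pc = pos` on a memory of
words with `2Q` in register `8` and `ℓ` in cell `40` (`M`-cell `0`), `ℓ + 121 ≤ Q`, `W ≥ 8`, the
epilogue halts within `epiCost ℓ` steps with cell `0 = ℓ` and cell `j` = old cell `40 + j` for
`1 ≤ j ≤ ℓ`; coins and query log are unchanged. [folklore] -/
theorem run_EPI {P : Program} {W pos : ℕ} {O : List ℕ → List ℕ} {ρ : ℕ → ℕ}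
    (hcode : CodeAt P pos (EPI pos)) {c : Cfg} (hpc : c.pc = some pos)
    (hmem : ∀ a, c.mem a < 2 ^ W) (h8 : c.mem 8 = 2 * Qv W) {ℓ : ℕ} (h40 : c.mem 40 = ℓ)
    (hℓ : ℓ + 121 ≤ Qv W) :
    ∃ n, n ≤ epiCost ℓ ∧ ∃ c' : Cfg, run P W O ρ n c = some c' ∧ c'.pc = none ∧
      c'.coinPos = c.coinPos ∧ c'.queries = c.queries ∧ c'.mem 0 = ℓ ∧
      ∀ j, 1 ≤ j → j ≤ ℓ → c'.mem j = c.mem (40 + j) := by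
  -- code placement
  simp only [EPI] at hcode
  obtain ⟨hc0, hc5⟩ := codeAt_append_iff.1 hcode
  obtain ⟨hc0, hc4⟩ := codeAt_append_iff.1 hc0
  obtain ⟨hc0, hc3⟩ := codeAt_append_iff.1 hc0
  obtain ⟨hc0, hc2⟩ := codeAt_append_iff.1 hc0
  obtain ⟨hc0, hc1⟩ := codeAt_append_iff.1 hc0
  simp only [List.length_append, List.length_map, loopBlock_length, E0_length, E1_length,
    cuBody_length, E2_length, Nat.reduceAdd] at hc1 hc2 hc3 hc4 hc5
  have hW : 8 ≤ W := eight_le_of_Qv (by omega)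
  have h4Q := four_mul_Qv (show 2 ≤ W by omega)
  have hQ := Qv_ge hW
  set H := 2 * Qv W with hH
  obtain ⟨pc0, m0, cp, qs⟩ := c
  simp only at hpc hmem h8 h40
  subst hpc
  -- phase 0 set-up (3 steps)
  obtain ⟨a33, a19, a20, af⟩ := execOps_E0 (W := W) m0
  have r1 := run_ops (P := P) (w := W) (O := O) (ρ := ρ) E0 hc0 (c := ⟨some pos, m0, cp, qs⟩) rfl
  set m1 := execOps W m0 E0 with hm1
  -- save loop: 40 rounds
  have hcu1 := iterate_cuBody (W := W) (mem := m1) (s₀ := 40) (d₀ := H) (n := 40) le_rfl (by omega)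
    (by omega) (by omega) (Or.inl (by omega)) a19 (by rw [a33, h8]) a20
  have r2 := run_while (P := P) (w := W) (O := O) (ρ := ρ) hc1 40 (c := ⟨some (pos + 3), m1, cp, qs⟩) rfl
    (fun j hj => by
      show ((fun m => execOps W m cuBody)^[j] m1) 20 ≠ 0
      rw [hcu1 j hj.le]; simp only [cuMem]; simp; omega)
    (by show ((fun m => execOps W m cuBody)^[40] m1) 20 = 0; rw [hcu1 _ le_rfl]; simp [cuMem])
  simp only [] at r2
  rw [hcu1 _ le_rfl] at r2
  set m2 := cuMem m1 40 H 40 40 with hm2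
  have hm2v : ∀ a, a ≠ 19 → a ≠ 20 → a ≠ 33 →
      m2 a = if H ≤ a ∧ a < H + 40 then m0 (40 + (a - H)) else m0 a := by
    intro a a19' a20' a33'
    simp only [hm2, cuMem, a19', a20', a33', if_false]
    split_ifs with h
    · exact af _ (by omega) (by omega) (by omega)
    · exact af _ a19' a20' a33'
  -- phase 1 set-up (3 steps)
  have h40' : m2 40 = ℓ := by rw [hm2v _ (by omega) (by omega) (by omega), if_neg (by omega), h40]
  obtain ⟨b20, b19, b33, bf⟩ := execOps_E1 (W := W) m2 (by rw [h40']; omega)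
  have r3 := run_ops (P := P) (w := W) (O := O) (ρ := ρ) E1 hc2 (c := ⟨some (pos + 9), m2, cp, qs⟩) rfl
  set m3 := execOps W m2 E1 with hm3
  -- restore loop: `ℓ + 1` rounds
  have hcu2 := iterate_cuBody (W := W) (mem := m3) (s₀ := 80) (d₀ := 40) (n := ℓ + 1) (by omega) le_rfl
    (by omega) (by omega) (Or.inr (by omega)) b19 b33 (by rw [b20, h40'])
  have r4 := run_while (P := P) (w := W) (O := O) (ρ := ρ) hc3 (ℓ + 1)
    (c := ⟨some (pos + 12), m3, cp, qs⟩) rfl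
    (fun j hj => by
      show ((fun m => execOps W m cuBody)^[j] m3) 20 ≠ 0
      rw [hcu2 j hj.le]; simp only [cuMem]; simp; omega)
    (by show ((fun m => execOps W m cuBody)^[ℓ + 1] m3) 20 = 0; rw [hcu2 _ le_rfl]; simp [cuMem])
  simp only [] at r4
  rw [hcu2 _ le_rfl] at r4
  set m4 := cuMem m3 80 40 (ℓ + 1) (ℓ + 1) with hm4
  have hm4hi : ∀ a, 40 ≤ a → m4 a = if a ≤ 40 + ℓ then m0 (40 + a) else m2 a := by
    intro a ha
    simp only [hm4, cuMem, show a ≠ 19 by omega, show a ≠ 33 by omega, show a ≠ 20 by omega, if_false]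
    by_cases hr : a ≤ 40 + ℓ
    · rw [if_pos (by omega), if_pos hr, bf _ (by omega) (by omega) (by omega),
        hm2v _ (by omega) (by omega) (by omega), if_neg (by omega), show 80 + (a - 40) = 40 + a by omega]
    · rw [if_neg (by omega), if_neg hr, bf _ (by omega) (by omega) (by omega)]
  have hm4_8 : m4 8 = H := by
    simp only [hm4, cuMem]; simp
    rw [bf _ (by omega) (by omega) (by omega), hm2v _ (by omega) (by omega) (by omega), if_neg (by omega), h8]
  -- phase 2 (81 steps) and halt
  obtain ⟨e0, emid, ehi⟩ := execOps_E2 (W := W) m4 hm4_8 (by omega) (by omega)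
  have r5 := run_ops (P := P) (w := W) (O := O) (ρ := ρ) E2 hc4 (c := ⟨some (pos + 18), m4, cp, qs⟩) rfl
  set m5 := execOps W m4 E2 with hm5
  have r6 : run P W O ρ 1 ⟨some (pos + 99), m5, cp, qs⟩ = some ⟨none, m5, cp, qs⟩ := by
    rw [run_one, step_halt rfl hc5.getElem?_zero]
  -- values
  have hsaved : ∀ j, j < 40 → m4 (H + j) = m0 (40 + j) := by
    intro j hj
    rw [hm4hi _ (by omega), if_neg (by omega), hm2v _ (by omega) (by omega) (by omega), if_pos (by omega),
      show 40 + (H + j - H) = 40 + j by omega]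
  simp only [E0_length, E1_length, cuBody_length, E2_length, Nat.add_assoc, Nat.reduceAdd] at r1 r2 r3 r4 r5
  refine ⟨3 + ((40 * 6 + 1) + (3 + (((ℓ + 1) * 6 + 1) + (81 + 1)))), by simp only [epiCost]; omega,
    ⟨none, m5, cp, qs⟩, ?_, rfl, rfl, rfl, ?_, fun j hj1 hjℓ => ?_⟩
  · exact run_add_of_run _ _ _ _ r1 (run_add_of_run _ _ _ _ r2 (run_add_of_run _ _ _ _ r3
      (run_add_of_run _ _ _ _ r4 (run_add_of_run _ _ _ _ r5 r6))))
  · show m5 0 = ℓ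
    rw [e0, show H = H + 0 by rfl, hsaved 0 (by omega), h40]
  · show m5 j = m0 (40 + j)
    rcases Nat.lt_or_ge j 40 with hj | hj
    · rw [emid _ hj1 (by omega), hsaved _ hj]
    · rw [ehi _ hj, hm4hi _ hj, if_pos (by omega)]

end Inline

end Literature.Computability.Cryptography.WordRAM
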